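import Mathlib.Tactic
import HarnessLib
import HarnessLib.Audit.Tags
import Summits.CriticalPhenomena.PercolationContinuityZ3.Theorems.PercNearOneGluingNoHeavyLowerTailSahiAntichainSplitSix

/-!
# Antichains, meets plus joins: three members above a four-member co-sunflower create three new labels (lemma E3c)

Support file (seat `prim-masterthm-p1`, gen 37; `--supports stmt-CriticalPhenomena-4575`).  No `sorry`, no new definitions, standard
axioms.  Memo `run/shared/lean/prim/prim-masterthm/FROM-prim-masterthm-p1-g37-LINEAR-REDUCTION.md` §4 (lemma E3c).

SETTING (files `…SahiAntichainSplit*`, `…Linear`, `…MidRange`): V5 (`2 #P ≤ #meets P + #joins P + 2` for antichains) was reduced to three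
finite lemmas L3, L4⁺, E3c (`two_mul_card_le_of_L3_L4_E3`).  E3c concerns a point `r` with exactly three members above whose own label
count is at most four (a 3-sunflower or 3-co-sunflower, `three_members_trichotomy`) and exactly four members below with all pairwise unions
equal (a 4-co-sunflower): it asks for `newLabels P r ≥ 3`.

NEW HERE ([this work], gen 37): **E3c is proved** (`three_le_newLabels_of_three_le_four_cofour`, in the exact form consumed by
`antichainMidRange_of`).  Ingredients, for `below = {b₁, …, b₄}` with `bᵢ ∪ bⱼ = U`: (Q) `U \ g ⊆ h` for distinct members `g, h` below, and
`U \ g ≠ ∅`.  (X2) **An old cross meet forces two new ones**: if `d ∩ d' ⊆ a` (`d ≠ d'` below, `a` above) then for the other two members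
`e, e'` the cross meets `a ∩ e`, `a ∩ e'` are distinct (`U \ e' ⊆ a ∩ e`) and new (an equation `a ∩ e = g ∩ g'` forces `e ∈ {g, g'}` and then
`U \ h ⊆ a` for an `h ∈ {d, d'}`, whence the other of `d, d'` lies inside `a`).  (Y0) **All cross joins old is impossible for a sunflower
above** (each member's cross join with a fixed `b` makes `b` swallow another member's petal and avoid the third member's petal — three such
constraints clash) **and gives four new meets for a co-sunflower above** (then every `b` contains `V \ a₁ ≠ ∅`, so the four cross meets
`a₁ ∩ bⱼ` are pairwise distinct and none is a meet of two members below).  (EQ) If no cross meet is old and all cross meets coincide, the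
four cross joins `a ∪ bⱼ` are distinct and new.  Assembly: `newJoins ≥ 1` (Y0), and `newMeets ≥ 2` (X2 or two distinct all-new cross
meets) or else `newJoins ≥ 4` (EQ).  Exhaustive data (`2^6`): `newLabels ≥ 5` in this configuration.
With this file the list of open lemmas for V5 is {L3: `f(5) ≥ 10`, L4⁺: six-member sides with ≤ 12 labels create four new labels}.
HONEST FRAMING: unconditional; V5 remains OPEN. [this work]
-/

namespace Summit.CriticalPhenomena.PercolationContinuityZ3.Theorems.SahiColouredDaykin

open Finset

variable {α : Type*} [DecidableEq α]

section CoFour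

variable {P : Finset (Finset α)} {r : α} {U : Finset α}

/-! ### 1. A co-sunflower below: co-petals -/

/-- In a co-sunflower side below (`g ∪ h = U` for distinct members), `U \ g ⊆ h`. [this work] -/
theorem sdiff_subset_of_below_cosunflower (hU : ∀ b ∈ below P r, ∀ b' ∈ below P r, b ≠ b' → b ∪ b' = U)
    {g h : Finset α} (hg : g ∈ below P r) (hh : h ∈ below P r) (hgh : g ≠ h) : U \ g ⊆ h := by
  intro x hx
  obtain ⟨hxU, hxg⟩ := mem_sdiff.1 hx
  rw [← hU g hg h hh hgh] at hxU
  rcases mem_union.1 hxU with h' | h'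
  · exact absurd h' hxg
  · exact h'

/-- Every member of a co-sunflower side below (with at least two members) lies inside `U`. [this work] -/
theorem subset_of_below_cosunflower (hU : ∀ b ∈ below P r, ∀ b' ∈ below P r, b ≠ b' → b ∪ b' = U) (h2 : 1 < #(below P r))
    {g : Finset α} (hg : g ∈ below P r) : g ⊆ U := by
  obtain ⟨h, hh, hne⟩ := exists_mem_ne h2 g
  rw [← hU g hg h hh hne.symm]; exact subset_union_left

/-- Co-petals are nonempty: `U \ g ≠ ∅` for a member `g` of an antichain co-sunflower side below with at least two members. [this work] -/
theorem sdiff_nonempty_of_below_cosunflower (hanti : IsAntichain (· ⊆ ·) (P : Set (Finset α)))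
    (hU : ∀ b ∈ below P r, ∀ b' ∈ below P r, b ≠ b' → b ∪ b' = U) (h2 : 1 < #(below P r))
    {g : Finset α} (hg : g ∈ below P r) : (U \ g).Nonempty := by
  obtain ⟨h, hh, hne⟩ := exists_mem_ne h2 g
  rw [nonempty_iff_ne_empty]
  intro h0
  have hUg : U ⊆ g := by
    intro x hx; by_contra hxg
    have : x ∈ U \ g := mem_sdiff.2 ⟨hx, hxg⟩
    rw [h0] at this; exact absurd this (notMem_empty _)
  have hhg : h ⊆ g := (subset_of_below_cosunflower hU h2 hh).trans hUg
  exact hanti (mem_coe.2 (below_subset P r hh)) (mem_coe.2 (below_subset P r hg)) hne hhg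

/-- A fourth member distinct from three given ones exists in a side with ≥ 4 members. [this work] -/
theorem exists_fourth {A : Finset (Finset α)} (h4 : 4 ≤ #A) (a e d : Finset α) : ∃ x ∈ A, x ≠ a ∧ x ≠ e ∧ x ≠ d := by
  by_contra h
  push Not at h
  have hsub : A ⊆ {a, e, d} := by
    intro x hx
    simp only [mem_insert, mem_singleton]
    by_contra hne
    push Not at hne
    exact hne.2.2 (h x hx hne.1 hne.2.1)
  have := (card_le_card hsub).trans card_le_three
  omega

/-! ### 2. (X2) An old cross meet forces two new cross meets -/

/-- If `d ∩ d' ⊆ a` for two distinct members `d, d'` of a four-member co-sunflower side below and `a` above, and `e` is a third member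
below, then the cross meet `a ∩ e` is new. [this work] -/
theorem inter_mem_newMeets_of_cofour (hanti : IsAntichain (· ⊆ ·) (P : Set (Finset α)))
    (hU : ∀ b ∈ below P r, ∀ b' ∈ below P r, b ≠ b' → b ∪ b' = U) (h4 : #(below P r) = 4)
    {a d d' e : Finset α} (ha : a ∈ above P r) (hd : d ∈ below P r) (hd' : d' ∈ below P r) (he : e ∈ below P r)
    (hdd' : d ≠ d') (hed : e ≠ d) (hed' : e ≠ d') (hsub : d ∩ d' ⊆ a) : a ∩ e ∈ newMeets P r := by
  have h2 : 1 < #(below P r) := by omega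
  obtain ⟨haP, hra⟩ := mem_above_iff.1 ha
  rw [inter_mem_newMeets_iff ha he]
  intro hold
  obtain ⟨g, hg, g', hg', hgg', heq⟩ := mem_meets_iff.1 hold
  -- `e ∈ {g, g'}`
  have hegg : e = g ∨ e = g' := by
    by_contra hne
    push Not at hne
    obtain ⟨x, hx⟩ := sdiff_nonempty_of_below_cosunflower hanti hU h2 he
    have hxg : x ∈ g := sdiff_subset_of_below_cosunflower hU he hg hne.1 hx
    have hxg' : x ∈ g' := sdiff_subset_of_below_cosunflower hU he hg' hne.2 hx
    have : x ∈ a ∩ e := by rw [heq]; exact mem_inter.2 ⟨hxg, hxg'⟩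
    exact (mem_sdiff.1 hx).2 (mem_inter.1 this).2
  -- the member of `{g, g'}` other than `e`
  obtain ⟨k, hk, hke, hkey⟩ : ∃ k ∈ below P r, k ≠ e ∧ a ∩ e = e ∩ k := by
    rcases hegg with rfl | rfl
    · exact ⟨g', hg', hgg'.symm, heq⟩
    · exact ⟨g, hg, hgg', by rw [heq, inter_comm]⟩
  -- pick `h ∈ {d, d'}` with `h ≠ k`; then `U \ h ⊆ e ∩ k ⊆ a` and the other of `d, d'` lies inside `a`
  have absorb : ∀ {h h' : Finset α}, h ∈ below P r → h' ∈ below P r → h ≠ h' → h ≠ k → h ≠ e → h ∩ h' ⊆ a → False := by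
    intro h h' hh hh' hhh' hhk hhe hhsub
    have h1 : U \ h ⊆ a := by
      intro x hx
      have hxe : x ∈ e := sdiff_subset_of_below_cosunflower hU hh he hhe hx
      have hxk : x ∈ k := sdiff_subset_of_below_cosunflower hU hh hk hhk hx
      have : x ∈ a ∩ e := by rw [hkey]; exact mem_inter.2 ⟨hxe, hxk⟩
      exact (mem_inter.1 this).1
    have hh'a : h' ⊆ a := by
      intro x hx
      by_cases hxh : x ∈ h
      · exact hhsub (mem_inter.2 ⟨hxh, hx⟩)
      · exact h1 (mem_sdiff.2 ⟨subset_of_below_cosunflower hU h2 hh' hx, hxh⟩)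
    have hne : h' ≠ a := by rintro rfl; exact (mem_below_iff.1 hh').2 hra
    exact hanti (mem_coe.2 (below_subset P r hh')) (mem_coe.2 haP) hne hh'a
  by_cases hdk : d = k
  · have hd'k : d' ≠ k := by rw [← hdk]; exact hdd'.symm
    exact absorb hd' hd hdd'.symm hd'k hed'.symm (by rw [inter_comm]; exact hsub)
  · exact absorb hd hd' hdd' hdk hed.symm hsub

/-- **(X2)** An old cross meet (`d ∩ d' ⊆ a`) over a four-member co-sunflower side forces two distinct new cross meets. [this work] -/
theorem two_le_card_newMeets_of_cofour (hanti : IsAntichain (· ⊆ ·) (P : Set (Finset α)))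
    (hU : ∀ b ∈ below P r, ∀ b' ∈ below P r, b ≠ b' → b ∪ b' = U) (h4 : #(below P r) = 4)
    {a d d' : Finset α} (ha : a ∈ above P r) (hd : d ∈ below P r) (hd' : d' ∈ below P r) (hdd' : d ≠ d')
    (hsub : d ∩ d' ⊆ a) : 2 ≤ #(newMeets P r) := by
  have h2 : 1 < #(below P r) := by omega
  obtain ⟨e, he, hea, hed, hed'⟩ := exists_fourth (by omega : 4 ≤ #(below P r)) a d d'
  obtain ⟨e', he', he'e, he'd, he'd'⟩ := exists_fourth (by omega : 4 ≤ #(below P r)) e d d'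
  have hZ := inter_mem_newMeets_of_cofour hanti hU h4 ha hd hd' he hdd' hed hed' hsub
  have hZ' := inter_mem_newMeets_of_cofour hanti hU h4 ha hd hd' he' hdd' he'd he'd' hsub
  -- distinct: `U \ e' ⊆ a ∩ e` but misses `e'`
  have hne : a ∩ e ≠ a ∩ e' := by
    intro h
    obtain ⟨x, hx⟩ := sdiff_nonempty_of_below_cosunflower hanti hU h2 he'
    have hxe : x ∈ e := sdiff_subset_of_below_cosunflower hU he' he he'e hx
    have hxd : x ∈ d := sdiff_subset_of_below_cosunflower hU he' hd he'd hx
    have hxd' : x ∈ d' := sdiff_subset_of_below_cosunflower hU he' hd' he'd' hx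
    have hxa : x ∈ a := hsub (mem_inter.2 ⟨hxd, hxd'⟩)
    have : x ∈ a ∩ e' := by rw [← h]; exact mem_inter.2 ⟨hxa, hxe⟩
    exact (mem_sdiff.1 hx).2 (mem_inter.1 this).2
  have hsub2 : ({a ∩ e, a ∩ e'} : Finset (Finset α)) ⊆ newMeets P r := by
    intro Z hZmem
    rcases mem_insert.1 hZmem with rfl | hZmem
    · exact hZ
    · rw [mem_singleton.1 hZmem]; exact hZ'
  have := card_le_card hsub2
  rwa [card_pair hne] at this

/-! ### 3. (Y0) All cross joins old: impossible for a sunflower above, four new meets for a co-sunflower above -/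

/-- With a sunflower side above: if `g`'s petal lies inside `b`, then `b ⊄ h ∪ e` for members `h, e` above other than `g`. [this work] -/
theorem not_subset_union_of_swallowed {K : Finset α} (hanti : IsAntichain (· ⊆ ·) (P : Set (Finset α))) (h2 : 1 < #(above P r))
    (hK : ∀ a ∈ above P r, ∀ a' ∈ above P r, a ≠ a' → a ∩ a' = K) {g h e b : Finset α}
    (hg : g ∈ above P r) (hh : h ∈ above P r) (he : e ∈ above P r) (hgh : g ≠ h) (hge : g ≠ e)
    (hsw : ∀ x ∈ g, x ∉ K → x ∈ b) (hb : b ⊆ h ∪ e) : False := by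
  obtain ⟨x, hxg, hxK⟩ := exists_mem_not_mem_core hanti h2 hK hg
  rcases mem_union.1 (hb (hsw x hxg hxK)) with hx | hx
  · exact hxK (mem_core_of_mem_mem hK hg hh hgh hxg hx)
  · exact hxK (mem_core_of_mem_mem hK hg he hge hxg hx)

/-- **(Y0, sunflower above)**: with three members above forming a sunflower and some member below, not all cross joins are old. [this work] -/
theorem newJoins_nonempty_of_sunflower_three {K : Finset α} (hanti : IsAntichain (· ⊆ ·) (P : Set (Finset α)))
    (h3 : #(above P r) = 3) (hB : (below P r).Nonempty)
    (hK : ∀ a ∈ above P r, ∀ a' ∈ above P r, a ≠ a' → a ∩ a' = K) : (newJoins P r).Nonempty := by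
  have h2 : 1 < #(above P r) := by omega
  obtain ⟨b, hb⟩ := hB
  obtain ⟨a₁, a₂, a₃, h12, h13, h23, hA⟩ := card_eq_three.1 h3
  have mem : ∀ a ∈ above P r, a = a₁ ∨ a = a₂ ∨ a = a₃ := by
    intro a ha; rw [hA, mem_insert, mem_insert, mem_singleton] at ha; exact ha
  have ha₁ : a₁ ∈ above P r := by rw [hA]; simp
  have ha₂ : a₂ ∈ above P r := by rw [hA]; simp
  have ha₃ : a₃ ∈ above P r := by rw [hA]; simp
  by_contra hempty
  rw [not_nonempty_iff_eq_empty] at hempty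
  have old : ∀ {a : Finset α}, a ∈ above P r → a ∪ b ∈ joins (above P r) := by
    intro a ha
    by_contra hnot
    have : a ∪ b ∈ newJoins P r := (union_mem_newJoins_iff ha hb).2 hnot
    rw [hempty] at this; exact absurd this (notMem_empty _)
  obtain ⟨e₁, he₁, hne₁, hsw₁, hsub₁⟩ := exists_swallowed_of_union_mem_joins hanti h2 hK ha₁ (old ha₁)
  obtain ⟨e₂, he₂, hne₂, hsw₂, hsub₂⟩ := exists_swallowed_of_union_mem_joins hanti h2 hK ha₂ (old ha₂)
  obtain ⟨e₃, he₃, hne₃, hsw₃, hsub₃⟩ := exists_swallowed_of_union_mem_joins hanti h2 hK ha₃ (old ha₃)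
  have NS := fun {g h e : Finset α} (hg : g ∈ above P r) (hh : h ∈ above P r) (he : e ∈ above P r) (hgh : g ≠ h) (hge : g ≠ e)
      (hsw : ∀ x ∈ g, x ∉ K → x ∈ b) (hb' : b ⊆ h ∪ e) => not_subset_union_of_swallowed hanti h2 hK hg hh he hgh hge hsw hb'
  rcases mem e₁ he₁ with rfl | rfl | rfl
  · exact hne₁ rfl
  · -- `b` swallows the petal of `a₂` and `b ⊆ a₁ ∪ a₂`
    rcases mem e₃ he₃ with rfl | rfl | rfl
    · -- `b ⊆ a₃ ∪ a₁` while swallowing `a₂`'s petal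
      exact NS ha₂ ha₃ ha₁ h23 h12.symm hsw₁ hsub₃
    · rcases mem e₂ he₂ with rfl | rfl | rfl
      · -- `b` swallows `a₁`'s petal and `b ⊆ a₃ ∪ a₂`
        exact NS ha₁ ha₃ ha₂ h13 h12 hsw₂ hsub₃
      · exact hne₂ rfl
      · -- `b` swallows `a₃`'s petal and `b ⊆ a₁ ∪ a₂`
        exact NS ha₃ ha₁ ha₂ h13.symm h23.symm hsw₂ hsub₁
    · exact hne₃ rfl
  · -- `b` swallows the petal of `a₃` and `b ⊆ a₁ ∪ a₃`
    rcases mem e₂ he₂ with rfl | rfl | rfl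
    · -- `b ⊆ a₂ ∪ a₁` while swallowing `a₃`'s petal
      exact NS ha₃ ha₂ ha₁ h23.symm h13.symm hsw₁ hsub₂
    · exact hne₂ rfl
    · rcases mem e₃ he₃ with rfl | rfl | rfl
      · -- `b` swallows `a₁`'s petal and `b ⊆ a₂ ∪ a₃`
        exact NS ha₁ ha₂ ha₃ h12 h13 hsw₃ hsub₂
      · -- `b` swallows `a₂`'s petal and `b ⊆ a₁ ∪ a₃`
        exact NS ha₂ ha₁ ha₃ h12.symm h23 hsw₃ hsub₁
      · exact hne₃ rfl

/-- **(Y0, co-sunflower above)**: with a co-sunflower side above (≥ 2 members), at least two members below, and all cross joins old,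
the cross meets of one member above with the members below are pairwise distinct and new: `#newMeets ≥ #below`. [this work] -/
theorem card_below_le_card_newMeets_of_cosunflower {V : Finset α} (hanti : IsAntichain (· ⊆ ·) (P : Set (Finset α)))
    (h2 : 1 < #(above P r)) (hV : ∀ a ∈ above P r, ∀ a' ∈ above P r, a ≠ a' → a ∪ a' = V)
    (hold : newJoins P r = ∅) : #(below P r) ≤ #(newMeets P r) := by
  obtain ⟨a₁, ha₁⟩ : (above P r).Nonempty := card_pos.1 (by omega)
  obtain ⟨a₂, ha₂, h21⟩ := exists_mem_ne h2 a₁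
  -- all cross joins equal `V`
  have hJV : ∀ W ∈ joins (above P r), W = V := by
    intro W hW
    obtain ⟨g, hg, g', hg', hgg', rfl⟩ := mem_joins_iff.1 hW
    exact hV g hg g' hg' hgg'
  have crossV : ∀ {a b : Finset α}, a ∈ above P r → b ∈ below P r → a ∪ b = V := by
    intro a b ha hb
    have : a ∪ b ∈ joins (above P r) := by
      by_contra hnot
      have hmem : a ∪ b ∈ newJoins P r := (union_mem_newJoins_iff ha hb).2 hnot
      rw [hold] at hmem; exact absurd hmem (notMem_empty _)
    exact hJV _ this
  -- a point of `a₂ \ a₁`; it lies in every member below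
  have hn21 : ¬ a₂ ⊆ a₁ := hanti (mem_coe.2 (above_subset P r ha₂)) (mem_coe.2 (above_subset P r ha₁)) h21
  obtain ⟨x, hx2, hx1⟩ := not_subset.1 hn21
  have hxb : ∀ {b : Finset α}, b ∈ below P r → x ∈ b := by
    intro b hb
    have : x ∈ a₁ ∪ b := by rw [crossV ha₁ hb, ← hV a₂ ha₂ a₁ ha₁ h21]; exact mem_union_left _ hx2
    rcases mem_union.1 this with h | h
    · exact absurd h hx1
    · exact h
  -- the map `b ↦ a₁ ∩ b` is injective on `below` with values in `newMeets`
  have hinj : Set.InjOn (fun b => a₁ ∩ b) (below P r : Set (Finset α)) := by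
    intro b hb b' hb' h
    exact eq_of_inter_eq_of_union_eq h (by rw [crossV ha₁ (mem_coe.1 hb), crossV ha₁ (mem_coe.1 hb')])
  have himg : (below P r).image (fun b => a₁ ∩ b) ⊆ newMeets P r := by
    intro Z hZ
    obtain ⟨b, hb, rfl⟩ := mem_image.1 hZ
    rw [inter_mem_newMeets_iff ha₁ hb]
    intro hold'
    obtain ⟨g, hg, g', hg', _, heq⟩ := mem_meets_iff.1 hold'
    have : x ∈ a₁ ∩ b := by rw [heq]; exact mem_inter.2 ⟨hxb hg, hxb hg'⟩
    exact hx1 (mem_inter.1 this).1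
  calc #(below P r) = #((below P r).image (fun b => a₁ ∩ b)) := (card_image_of_injOn hinj).symm
    _ ≤ #(newMeets P r) := card_le_card himg

/-! ### 4. (EQ) Constant cross meets force distinct new cross joins -/

/-- If all cross meets coincide and none is old... more simply: if the cross meets at `r` number at most one, then for a member `a` above
the cross joins `a ∪ b` (`b` below) are pairwise distinct and new, so `#newJoins ≥ #below`. [this work] -/
theorem card_below_le_card_newJoins_of_crossMeets_le_one (hanti : IsAntichain (· ⊆ ·) (P : Set (Finset α)))
    (hX : #(crossMeets P r) ≤ 1) {a : Finset α} (ha : a ∈ above P r) (hBU : ∀ b ∈ below P r, b ⊆ U)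
    (hU2 : ∃ b₁ ∈ below P r, ∃ b₂ ∈ below P r, b₁ ∪ b₂ = U) : #(below P r) ≤ #(newJoins P r) := by
  obtain ⟨haP, hra⟩ := mem_above_iff.1 ha
  -- all cross meets are equal
  have hXeq : ∀ {g : Finset α} {b : Finset α}, g ∈ above P r → b ∈ below P r → ∀ {g' b' : Finset α}, g' ∈ above P r →
      b' ∈ below P r → g ∩ b = g' ∩ b' := by
    intro g b hg hb g' b' hg' hb'
    obtain ⟨hgP, hrg⟩ := mem_above_iff.1 hg
    obtain ⟨hbP, hrb⟩ := mem_below_iff.1 hb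
    obtain ⟨hg'P, hrg'⟩ := mem_above_iff.1 hg'
    obtain ⟨hb'P, hrb'⟩ := mem_below_iff.1 hb'
    exact card_le_one.1 hX _ (mem_crossMeets_iff.2 ⟨g, hgP, b, hbP, hrg, hrb, rfl⟩)
      _ (mem_crossMeets_iff.2 ⟨g', hg'P, b', hb'P, hrg', hrb', rfl⟩)
  -- every member above meets `U` in the common cross meet `T = a ∩ b₁`
  obtain ⟨b₁, hb₁, b₂, hb₂, hU12⟩ := hU2
  have hgU : ∀ {g : Finset α}, g ∈ above P r → g ∩ U ⊆ a := by
    intro g hg x hx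
    obtain ⟨hxg, hxU⟩ := mem_inter.1 hx
    rw [← hU12] at hxU
    rcases mem_union.1 hxU with h | h
    · have : x ∈ a ∩ b₁ := by rw [hXeq ha hb₁ hg hb₁]; exact mem_inter.2 ⟨hxg, h⟩
      exact (mem_inter.1 this).1
    · have : x ∈ a ∩ b₂ := by rw [hXeq ha hb₂ hg hb₂]; exact mem_inter.2 ⟨hxg, h⟩
      exact (mem_inter.1 this).1
  have hinj : Set.InjOn (fun b => a ∪ b) (below P r : Set (Finset α)) := by
    intro b hb b' hb' h
    exact eq_of_inter_eq_of_union_eq (hXeq ha (mem_coe.1 hb) ha (mem_coe.1 hb')) h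
  have himg : (below P r).image (fun b => a ∪ b) ⊆ newJoins P r := by
    intro W hW
    obtain ⟨b, hb, rfl⟩ := mem_image.1 hW
    rw [union_mem_newJoins_iff ha hb]
    intro hold
    obtain ⟨g, hg, g', hg', _, heq⟩ := mem_joins_iff.1 hold
    -- `b ⊆ (g ∪ g') ∩ U ⊆ a`
    have hba : b ⊆ a := by
      intro x hxb
      have hxU : x ∈ U := hBU b hb hxb
      have : x ∈ g ∪ g' := by rw [← heq]; exact mem_union_right _ hxb
      rcases mem_union.1 this with h | h
      · exact hgU hg (mem_inter.2 ⟨h, hxU⟩)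
      · exact hgU hg' (mem_inter.2 ⟨h, hxU⟩)
    have hne : b ≠ a := by rintro rfl; exact (mem_below_iff.1 hb).2 hra
    exact hanti (mem_coe.2 (below_subset P r hb)) (mem_coe.2 haP) hne hba
  calc #(below P r) = #((below P r).image (fun b => a ∪ b)) := (card_image_of_injOn hinj).symm
    _ ≤ #(newJoins P r) := card_le_card himg

/-! ### 5. Lemma E3c -/

/-- **E3c.**  Three members above with at most four labels of their own (a 3-sunflower or 3-co-sunflower), four members below with all
pairwise unions equal (a 4-co-sunflower): the split creates at least three new labels. [this work] -/
theorem three_le_newLabels_of_three_cofour (hanti : IsAntichain (· ⊆ ·) (P : Set (Finset α)))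
    (h3 : #(above P r) = 3) (h4 : #(below P r) = 4) (hf : #(meets (above P r)) + #(joins (above P r)) ≤ 4)
    (hU : ∀ b ∈ below P r, ∀ b' ∈ below P r, b ≠ b' → b ∪ b' = U) : 3 ≤ newLabels P r := by
  have hA2 : 1 < #(above P r) := by omega
  have hB2 : 1 < #(below P r) := by omega
  have hA : (above P r).Nonempty := card_pos.1 (by omega)
  have hB : (below P r).Nonempty := card_pos.1 (by omega)
  unfold newLabels
  -- (Y0): a new join exists, or four new meets
  have hY : 1 ≤ #(newJoins P r) ∨ 4 ≤ #(newMeets P r) := by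
    by_cases h0 : newJoins P r = ∅
    · rcases three_members_trichotomy (isAntichain_above hanti r) h3 with ⟨K, hK⟩ | ⟨V, hV⟩ | h5
      · have := newJoins_nonempty_of_sunflower_three hanti h3 hB hK
        rw [h0] at this; exact absurd this (not_nonempty_empty)
      · have := card_below_le_card_newMeets_of_cosunflower hanti hA2 hV h0
        omega
      · omega
    · exact Or.inl (card_pos.2 (nonempty_iff_ne_empty.2 h0))
  -- (X2) / all-new: two new meets, or else (EQ) four new joins
  have hX : 2 ≤ #(newMeets P r) ∨ 4 ≤ #(newJoins P r) := by
    by_cases hold : ∃ a ∈ above P r, ∃ b ∈ below P r, a ∩ b ∈ meets (below P r)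
    · obtain ⟨a, ha, b, hb, hmem⟩ := hold
      obtain ⟨d, hd, d', hd', hdd', heq⟩ := mem_meets_iff.1 hmem
      exact Or.inl (two_le_card_newMeets_of_cofour hanti hU h4 ha hd hd' hdd' (by rw [← heq]; exact inter_subset_left))
    · push Not at hold
      -- every cross meet is new: `newMeets = crossMeets`
      have hXN : crossMeets P r ⊆ newMeets P r := by
        intro Z hZ
        obtain ⟨a, haP, b, hbP, hra, hrb, rfl⟩ := mem_crossMeets_iff.1 hZ
        exact (inter_mem_newMeets_iff (mem_above_iff.2 ⟨haP, hra⟩) (mem_below_iff.2 ⟨hbP, hrb⟩)).2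
          (hold a (mem_above_iff.2 ⟨haP, hra⟩) b (mem_below_iff.2 ⟨hbP, hrb⟩))
      by_cases hX1 : #(crossMeets P r) ≤ 1
      · obtain ⟨a, ha⟩ := hA
        obtain ⟨b₁, hb₁⟩ := hB
        obtain ⟨b₂, hb₂, h21⟩ := exists_mem_ne hB2 b₁
        have := card_below_le_card_newJoins_of_crossMeets_le_one (U := U) hanti hX1 ha
          (fun b hb => subset_of_below_cosunflower hU hB2 hb) ⟨b₁, hb₁, b₂, hb₂, hU b₁ hb₁ b₂ hb₂ h21.symm⟩
        omega
      · have := card_le_card hXN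
        omega
  rcases hY with hY | hY <;> rcases hX with hX | hX <;> omega

/-- E3c in the form consumed by `antichainMidRange_of` (`…SahiAntichainMidRange`): `#joins (below) ≤ 1` in place of the co-sunflower
hypothesis. [this work] -/
theorem three_le_newLabels_of_three_le_four_cofour (P : Finset (Finset α)) (r : α)
    (hanti : IsAntichain (· ⊆ ·) (P : Set (Finset α))) (h3 : #(above P r) = 3) (h4 : #(below P r) = 4)
    (hf : #(meets (above P r)) + #(joins (above P r)) ≤ 4) (hJ : #(joins (below P r)) ≤ 1) : 3 ≤ newLabels P r := by
  obtain ⟨b₁, b₂, hb₁, hb₂, h12⟩ := one_lt_card_iff.1 (by omega : 1 < #(below P r))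
  have hU : ∀ b ∈ below P r, ∀ b' ∈ below P r, b ≠ b' → b ∪ b' = b₁ ∪ b₂ := by
    intro b hb b' hb' hbb'
    exact card_le_one.1 hJ _ (mem_joins_iff.2 ⟨b, hb, b', hb', hbb', rfl⟩) _ (mem_joins_iff.2 ⟨b₁, hb₁, b₂, hb₂, h12, rfl⟩)
  exact three_le_newLabels_of_three_cofour hanti h3 h4 hf hU

end CoFour

end Summit.CriticalPhenomena.PercolationContinuityZ3.Theorems.SahiColouredDaykin
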